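import Literature.Computability.Complexity.ExtMonotoneCircuits
import Literature.Computability.Complexity.MonotoneSwitching
import Literature.Computability.Complexity.CliqueTestGraphs
import Summits.PneNP.PneNP.Theorems.ConvexRankGatesCliqueExtLowerBoundWidthThresholdDefs
import Mathlib

/-!
# Sandwich helpers for the stubs `stub_algebraicSandwichable` / `stub_convSandwichable` of the line
`width-threshold-certificate-sparsity` (crux `ConvexRankGates.CliqueExtLowerBound`, stmt-PneNP-10682)

The two open stubs ask that a wide gate `φ`, fed with local child pairs (`D j` an `(r-1)`-DNF
below `C j` an `(s-1)`-CNF over the edge slots), be SANDWICHABLE on the referee pair `(P, N)`: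
there is a local pair `dnf ≤ cnf` with `φ(D(x)) ≤ dnf(x)` off `ε · #P` positives and
`cnf(x) ≤ φ(C(x))` off `ε · #N` negatives (`Sandwichable`, `…WidthThresholdDefs`). Proved here, for
ANY gate `φ`, index type `ι`, families `P N`, children `D C` and `ε` (nothing depends on the gate
class), writing `U₁ = {x ∈ P : φ(dval D x) = 1}` (accepted positives) and
`V₀ = {x ∈ N : φ(cval C x) = 0}` (rejected negatives):

* §1 LEGALITY: `dnf ≤ cnf` pointwise iff every monomial of `dnf` meets every clause of `cnf`
  (`le_iff_cross`); so a legal pair with a clause `S₀ ∈ cnf` only covers inputs meeting `S₀`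
  (`satClause_of_le`).
* §2 CHEAP EXITS: blind on the positives (`#U₁ ≤ ε#P`) ⇒ the constant pair `(∅, {∅})` works
  (`exists_sandwich_of_pos_blind`); blind on the negatives (`#V₀ ≤ ε#N`) ⇒ `({∅}, ∅)` works
  (`exists_sandwich_of_neg_blind`); the HUB lemma (`exists_sandwich_of_hub`): any cross-intersecting
  pair of local families `(𝓜, 𝓢)` is a legal pair, so families can simply be plugged in; its
  corollaries the ANCHOR lemmas (`exists_sandwich_of_anchor`: one slot `e₀` on in all but `ε#P` of
  `U₁` and off in all but `ε#N` of `V₀` ⇒ `({{e₀}}, {{e₀}})`; `exists_sandwich_of_orAnchor`: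
  `({{e}}_{e ∈ A}, {A})`; `exists_sandwich_of_andAnchor`: `({A}, {{e}}_{e ∈ A})`).
* §3 NECESSARY CONDITIONS (`sandwich_dichotomy`): a sandwichable gate is either blind on the
  negatives (`cnf = ∅` forces `#V₀ ≤ ε#N`) or, for some clause `S₀` of fewer than `s` slots, accepts
  at most `ε#P` positives with `S₀` entirely off. On the referee pair (`P` = bare `k`-cliques) the
  positives meeting a fixed `S₀` are at most `#S₀ · C(m-2,k-2)`, so SANDWICHABLE ⇒ "blind on the
  negatives" ∨ "accepts `≤ (ε + (s-1)k(k-1)/(m(m-1))) · #P` positives": a counterexample to the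
  stubs is exactly a wide gate with local children rejecting `> ε#N` negatives AND accepting
  `≫ s k²/m² · #P` bare cliques (acceptance spread over unboundedly many anchors, while the dense
  negatives are still rejected with probability `≥ m^{-c-1}/8`).
* §4 CHARACTERISATION (`sandwich_iff`, `ε ≥ 0`): sandwichability depends on the clause family
  alone — it holds iff `#V₀ ≤ ε#N`, or some nonempty `s`-local `𝓢` is switched off (some `S ∈ 𝓢`
  inside the off-set) by all but `ε#N` of `V₀` while all but `ε#P` of `U₁` switch on fewer than `r`
  slots meeting every member of `𝓢` (then `dnf :=` all such small transversals, `cnf := 𝓢`).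
* §5 `sandwich_cheap_exit`: registered binder-free corollary (the two blind exits, in the unfolded
  vocabulary of the stubs).

All error sets are written with `EvalDNF` / `EvalCNF` / `SatClause` / `SatTerm` (classical
decidability, as in `Sandwichable`), so that the statements match the stubs' filters syntactically.
-/

set_option linter.dupNamespace false

open Literature.Computability.Complexity Filter Finset

namespace Summit.PneNP.PneNP.Theorems.CliqueExtLowerBound.WidthThreshold.SandwichHelpers

open Summit.PneNP.PneNP.Theorems.CliqueExtLowerBound.WidthThreshold

section General

variable {ι : Type}

/-! ## §1 Legality of a pair -/

/-- A cross-intersecting pair is legal: if every monomial of `dnf` meets every clause of `cnf`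
then `dnf ≤ cnf` pointwise. [folklore] -/
theorem le_of_cross {dnf cnf : Finset (Finset ι)}
    (h : ∀ R ∈ dnf, ∀ S ∈ cnf, ∃ i ∈ R, i ∈ S) : ∀ x, EvalDNF dnf x → EvalCNF cnf x := by
  rintro x ⟨R, hR, hx⟩ S hS
  obtain ⟨i, hiR, hiS⟩ := h R hR S hS
  exact ⟨i, hiS, hx i hiR⟩

/-- Conversely a legal pair is cross-intersecting (test `dnf ≤ cnf` on the indicator of a
monomial). [folklore] -/
theorem cross_of_le [DecidableEq ι] {dnf cnf : Finset (Finset ι)}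
    (h : ∀ x, EvalDNF dnf x → EvalCNF cnf x) : ∀ R ∈ dnf, ∀ S ∈ cnf, ∃ i ∈ R, i ∈ S := by
  intro R hR S hS
  obtain ⟨i, hiS, hi⟩ := h (fun i => decide (i ∈ R)) ⟨R, hR, fun i hi => by simpa using hi⟩ S hS
  exact ⟨i, by simpa using hi, hiS⟩

/-- `dnf ≤ cnf` pointwise iff every monomial meets every clause. [folklore] -/
theorem le_iff_cross [DecidableEq ι] {dnf cnf : Finset (Finset ι)} :
    (∀ x, EvalDNF dnf x → EvalCNF cnf x) ↔ ∀ R ∈ dnf, ∀ S ∈ cnf, ∃ i ∈ R, i ∈ S :=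
  ⟨cross_of_le, le_of_cross⟩

/-- In a legal pair, every input switching the DNF on satisfies every clause `S₀` of the CNF.
[folklore] -/
theorem satClause_of_le {dnf cnf : Finset (Finset ι)} (h : ∀ x, EvalDNF dnf x → EvalCNF cnf x)
    {S₀ : Finset ι} (hS₀ : S₀ ∈ cnf) {x : ι → Bool} (hx : EvalDNF dnf x) : SatClause S₀ x :=
  h x hx S₀ hS₀

/-- A clause is falsified iff all its slots are off. [folklore] -/
theorem not_satClause_iff {S : Finset ι} {x : ι → Bool} :
    ¬ SatClause S x ↔ ∀ i ∈ S, x i = false := by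
  simp [SatClause]

/-- A monomial is falsified iff one of its slots is off. [folklore] -/
theorem not_satTerm_iff {R : Finset ι} {x : ι → Bool} :
    ¬ SatTerm R x ↔ ∃ i ∈ R, x i = false := by
  simp [SatTerm]

/-- A CNF holds iff no clause is entirely off ("no certificate inside the off-set"). [folklore] -/
theorem evalCNF_iff_not_exists {F : Finset (Finset ι)} {x : ι → Bool} :
    EvalCNF F x ↔ ¬ ∃ S ∈ F, ∀ i ∈ S, x i = false := by
  simp only [EvalCNF, not_exists, not_and, ← not_satClause_iff, not_not]

/-! ## §2 Cheap exits: blind gates, hubs and anchors -/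

open Classical in
/-- **Blind on the positives ⇒ sandwichable by the constant pair `(∅, {∅})`** (both sides the
constant `0`; no locality needed): it suffices that `φ` accepts, through the DNF children, at most
`ε · #P` positives. [folklore] -/
theorem exists_sandwich_of_pos_blind (φ : GateFn) (P N : Finset (ι → Bool)) {ε : ℝ} (hε : 0 ≤ ε)
    (r s : ℕ) (D C : Fin φ.1 → Finset (Finset ι))
    (hP : (#(P.filter fun x => φ.2 (dval D x) = true) : ℝ) ≤ ε * #P) :
    ∃ dnf cnf : Finset (Finset ι), IsLocal r dnf ∧ IsLocal s cnf ∧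
      (∀ x, EvalDNF dnf x → EvalCNF cnf x) ∧
      (#(P.filter fun x => φ.2 (dval D x) = true ∧ ¬ EvalDNF dnf x) : ℝ) ≤ ε * #P ∧
      (#(N.filter fun x => EvalCNF cnf x ∧ φ.2 (cval C x) = false) : ℝ) ≤ ε * #N := by
  refine ⟨∅, {∅}, fun R hR => by simp at hR, fun S hS => by simp [mem_singleton.1 hS],
    fun x hx => absurd hx not_evalDNF_empty, ?_, ?_⟩
  · have : P.filter (fun x => φ.2 (dval D x) = true ∧ ¬ EvalDNF (∅ : Finset (Finset ι)) x) =
        P.filter fun x => φ.2 (dval D x) = true :=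
      filter_congr fun x _ => by simp
    rwa [this]
  · have : N.filter (fun x => EvalCNF ({∅} : Finset (Finset ι)) x ∧ φ.2 (cval C x) = false) = ∅ :=
      filter_eq_empty_iff.2 fun x _ h => not_evalCNF_singleton_empty h.1
    rw [this, card_empty, Nat.cast_zero]
    positivity

open Classical in
/-- **Blind on the negatives ⇒ sandwichable by the constant pair `({∅}, ∅)`** (both sides the
constant `1`): it suffices that `φ` rejects, through the CNF children, at most `ε · #N` negatives.
[folklore] -/
theorem exists_sandwich_of_neg_blind (φ : GateFn) (P N : Finset (ι → Bool)) {ε : ℝ} (hε : 0 ≤ ε)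
    (r s : ℕ) (D C : Fin φ.1 → Finset (Finset ι))
    (hN : (#(N.filter fun x => φ.2 (cval C x) = false) : ℝ) ≤ ε * #N) :
    ∃ dnf cnf : Finset (Finset ι), IsLocal r dnf ∧ IsLocal s cnf ∧
      (∀ x, EvalDNF dnf x → EvalCNF cnf x) ∧
      (#(P.filter fun x => φ.2 (dval D x) = true ∧ ¬ EvalDNF dnf x) : ℝ) ≤ ε * #P ∧
      (#(N.filter fun x => EvalCNF cnf x ∧ φ.2 (cval C x) = false) : ℝ) ≤ ε * #N := by
  refine ⟨{∅}, ∅, fun R hR => by simp [mem_singleton.1 hR], fun S hS => by simp at hS,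
    fun x _ => evalCNF_empty, ?_, ?_⟩
  · have : P.filter (fun x => φ.2 (dval D x) = true ∧ ¬ EvalDNF ({∅} : Finset (Finset ι)) x) = ∅ :=
      filter_eq_empty_iff.2 fun x _ h => h.2 evalDNF_singleton_empty
    rw [this, card_empty, Nat.cast_zero]
    positivity
  · have : N.filter (fun x => EvalCNF (∅ : Finset (Finset ι)) x ∧ φ.2 (cval C x) = false) =
        N.filter fun x => φ.2 (cval C x) = false :=
      filter_congr fun x _ => by simp
    rwa [this]

open Classical in
/-- **Hub lemma.** Any `r`-local monomial family `𝓜` and `s`-local clause family `𝓢` such that every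
`R ∈ 𝓜` meets every `S ∈ 𝓢` form a legal pair `(𝓜, 𝓢)`; its positive error is the set of accepted
positives switching on no `R ∈ 𝓜` (`¬ EvalDNF 𝓜 x`: no `R ⊆ on(x)`), its negative error the set of
rejected negatives switching off no `S ∈ 𝓢` (`EvalCNF 𝓢 x`: no `S ⊆ off(x)`, cf.
`evalCNF_iff_not_exists`). So candidate families can simply be plugged in. [folklore] -/
theorem exists_sandwich_of_hub (φ : GateFn) (P N : Finset (ι → Bool)) (ε : ℝ) {r s : ℕ}
    (D C : Fin φ.1 → Finset (Finset ι)) (𝓜 𝓢 : Finset (Finset ι))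
    (h𝓜 : IsLocal r 𝓜) (h𝓢 : IsLocal s 𝓢) (hcross : ∀ R ∈ 𝓜, ∀ S ∈ 𝓢, ∃ i ∈ R, i ∈ S)
    (hP : (#(P.filter fun x => φ.2 (dval D x) = true ∧ ¬ EvalDNF 𝓜 x) : ℝ) ≤ ε * #P)
    (hN : (#(N.filter fun x => EvalCNF 𝓢 x ∧ φ.2 (cval C x) = false) : ℝ) ≤ ε * #N) :
    ∃ dnf cnf : Finset (Finset ι), IsLocal r dnf ∧ IsLocal s cnf ∧
      (∀ x, EvalDNF dnf x → EvalCNF cnf x) ∧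
      (#(P.filter fun x => φ.2 (dval D x) = true ∧ ¬ EvalDNF dnf x) : ℝ) ≤ ε * #P ∧
      (#(N.filter fun x => EvalCNF cnf x ∧ φ.2 (cval C x) = false) : ℝ) ≤ ε * #N :=
  ⟨𝓜, 𝓢, h𝓜, h𝓢, le_of_cross hcross, hP, hN⟩

open Classical in
/-- **Anchor lemma.** If one slot `e₀` is ON in all but `ε · #P` of the accepted positives and OFF in
all but `ε · #N` of the rejected negatives, the pair `({{e₀}}, {{e₀}})` (both sides the variable
`x_{e₀}`) sandwiches `φ` (`r, s ≥ 2`). Every gate all of whose children's monomials and clauses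
contain `e₀` is of this kind with zero error (e.g. the anchored theta gate refuting
`stub_convReplaceable`). [folklore] -/
theorem exists_sandwich_of_anchor (φ : GateFn) (P N : Finset (ι → Bool)) (ε : ℝ) {r s : ℕ}
    (hr : 2 ≤ r) (hs : 2 ≤ s) (D C : Fin φ.1 → Finset (Finset ι)) (e₀ : ι)
    (hP : (#(P.filter fun x => φ.2 (dval D x) = true ∧ x e₀ = false) : ℝ) ≤ ε * #P)
    (hN : (#(N.filter fun x => x e₀ = true ∧ φ.2 (cval C x) = false) : ℝ) ≤ ε * #N) :
    ∃ dnf cnf : Finset (Finset ι), IsLocal r dnf ∧ IsLocal s cnf ∧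
      (∀ x, EvalDNF dnf x → EvalCNF cnf x) ∧
      (#(P.filter fun x => φ.2 (dval D x) = true ∧ ¬ EvalDNF dnf x) : ℝ) ≤ ε * #P ∧
      (#(N.filter fun x => EvalCNF cnf x ∧ φ.2 (cval C x) = false) : ℝ) ≤ ε * #N := by
  refine exists_sandwich_of_hub φ P N ε D C {{e₀}} {{e₀}} (fun R hR => ?_) (fun S hS => ?_)
    (fun R hR S hS => ⟨e₀, by simp [mem_singleton.1 hR], by simp [mem_singleton.1 hS]⟩) ?_ ?_
  · rw [mem_singleton.1 hR, card_singleton]; omega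
  · rw [mem_singleton.1 hS, card_singleton]; omega
  · have : P.filter (fun x => φ.2 (dval D x) = true ∧ ¬ EvalDNF ({{e₀}} : Finset (Finset ι)) x) =
        P.filter fun x => φ.2 (dval D x) = true ∧ x e₀ = false :=
      filter_congr fun x _ => by rw [evalDNF_singleton_singleton]; simp
    rwa [this]
  · have : N.filter (fun x => EvalCNF ({{e₀}} : Finset (Finset ι)) x ∧ φ.2 (cval C x) = false) =
        N.filter fun x => x e₀ = true ∧ φ.2 (cval C x) = false :=
      filter_congr fun x _ => by rw [evalCNF_singleton_singleton]
    rwa [this]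

open Classical in
/-- **OR-anchor.** If a set `A` of fewer than `s` slots meets the on-set of all but `ε · #P` accepted
positives (`SatClause A`) and lies inside the off-set of all but `ε · #N` rejected negatives, the pair
`({{e}}_{e ∈ A}, {A})` (both sides `⋁_{e ∈ A} x_e`) sandwiches `φ` (`r ≥ 2`): OR-like gates whose
acceptance is pierced by few slots that the rejected negatives all switch off. [folklore] -/
theorem exists_sandwich_of_orAnchor [DecidableEq ι] (φ : GateFn) (P N : Finset (ι → Bool)) (ε : ℝ)
    {r s : ℕ} (hr : 2 ≤ r) (D C : Fin φ.1 → Finset (Finset ι)) (A : Finset ι) (hA : #A ≤ s - 1)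
    (hP : (#(P.filter fun x => φ.2 (dval D x) = true ∧ ¬ SatClause A x) : ℝ) ≤ ε * #P)
    (hN : (#(N.filter fun x => SatClause A x ∧ φ.2 (cval C x) = false) : ℝ) ≤ ε * #N) :
    ∃ dnf cnf : Finset (Finset ι), IsLocal r dnf ∧ IsLocal s cnf ∧
      (∀ x, EvalDNF dnf x → EvalCNF cnf x) ∧
      (#(P.filter fun x => φ.2 (dval D x) = true ∧ ¬ EvalDNF dnf x) : ℝ) ≤ ε * #P ∧
      (#(N.filter fun x => EvalCNF cnf x ∧ φ.2 (cval C x) = false) : ℝ) ≤ ε * #N := by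
  refine exists_sandwich_of_hub φ P N ε D C (A.image fun e => {e}) {A} (fun R hR => ?_)
    (fun S hS => by rwa [mem_singleton.1 hS]) (fun R hR S hS => ?_) ?_ ?_
  · obtain ⟨e, -, rfl⟩ := mem_image.1 hR
    rw [card_singleton]; omega
  · obtain ⟨e, he, rfl⟩ := mem_image.1 hR
    exact ⟨e, mem_singleton_self _, by rwa [mem_singleton.1 hS]⟩
  · have : P.filter (fun x => φ.2 (dval D x) = true ∧
        ¬ EvalDNF (A.image fun e => ({e} : Finset ι)) x) =
        P.filter fun x => φ.2 (dval D x) = true ∧ ¬ SatClause A x :=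
      filter_congr fun x _ => by simp [EvalDNF, SatTerm, SatClause]
    rwa [this]
  · have : N.filter (fun x => EvalCNF ({A} : Finset (Finset ι)) x ∧ φ.2 (cval C x) = false) =
        N.filter fun x => SatClause A x ∧ φ.2 (cval C x) = false :=
      filter_congr fun x _ => by simp [EvalCNF]
    rwa [this]

open Classical in
/-- **AND-anchor.** Dually, if a set `A` of fewer than `r` slots lies inside the on-set of all but
`ε · #P` accepted positives (`SatTerm A`) and meets the off-set of all but `ε · #N` rejected
negatives, the pair `({A}, {{e}}_{e ∈ A})` (both sides `⋀_{e ∈ A} x_e`) sandwiches `φ` (`s ≥ 2`).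
[folklore] -/
theorem exists_sandwich_of_andAnchor [DecidableEq ι] (φ : GateFn) (P N : Finset (ι → Bool))
    (ε : ℝ) {r s : ℕ} (hs : 2 ≤ s) (D C : Fin φ.1 → Finset (Finset ι)) (A : Finset ι)
    (hA : #A ≤ r - 1)
    (hP : (#(P.filter fun x => φ.2 (dval D x) = true ∧ ¬ SatTerm A x) : ℝ) ≤ ε * #P)
    (hN : (#(N.filter fun x => SatTerm A x ∧ φ.2 (cval C x) = false) : ℝ) ≤ ε * #N) :
    ∃ dnf cnf : Finset (Finset ι), IsLocal r dnf ∧ IsLocal s cnf ∧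
      (∀ x, EvalDNF dnf x → EvalCNF cnf x) ∧
      (#(P.filter fun x => φ.2 (dval D x) = true ∧ ¬ EvalDNF dnf x) : ℝ) ≤ ε * #P ∧
      (#(N.filter fun x => EvalCNF cnf x ∧ φ.2 (cval C x) = false) : ℝ) ≤ ε * #N := by
  refine exists_sandwich_of_hub φ P N ε D C {A} (A.image fun e => {e})
    (fun R hR => by rwa [mem_singleton.1 hR]) (fun S hS => ?_) (fun R hR S hS => ?_) ?_ ?_
  · obtain ⟨e, -, rfl⟩ := mem_image.1 hS
    rw [card_singleton]; omega
  · obtain ⟨e, he, rfl⟩ := mem_image.1 hS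
    exact ⟨e, by rwa [mem_singleton.1 hR], mem_singleton_self _⟩
  · have : P.filter (fun x => φ.2 (dval D x) = true ∧ ¬ EvalDNF ({A} : Finset (Finset ι)) x) =
        P.filter fun x => φ.2 (dval D x) = true ∧ ¬ SatTerm A x :=
      filter_congr fun x _ => by simp [EvalDNF]
    rwa [this]
  · have : N.filter (fun x => EvalCNF (A.image fun e => ({e} : Finset ι)) x ∧
        φ.2 (cval C x) = false) = N.filter fun x => SatTerm A x ∧ φ.2 (cval C x) = false :=
      filter_congr fun x _ => by simp [EvalCNF, SatTerm, SatClause]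
    rwa [this]

/-! ## §3 Necessary conditions: the two horns -/

open Classical in
/-- **Positive horn.** If a legal pair covers all but `ε · #P` of the accepted positives and `S₀` is a
clause of its CNF, then at most `ε · #P` accepted positives falsify `S₀` (have `S₀` entirely off):
acceptance is pierced by the fewer than `s` slots of `S₀`. [folklore] -/
theorem card_filter_off_le_of_sandwich (φ : GateFn) (P : Finset (ι → Bool)) (ε : ℝ)
    (D : Fin φ.1 → Finset (Finset ι)) {dnf cnf : Finset (Finset ι)}
    (hle : ∀ x, EvalDNF dnf x → EvalCNF cnf x) {S₀ : Finset ι} (hS₀ : S₀ ∈ cnf)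
    (hP : (#(P.filter fun x => φ.2 (dval D x) = true ∧ ¬ EvalDNF dnf x) : ℝ) ≤ ε * #P) :
    (#(P.filter fun x => φ.2 (dval D x) = true ∧ ¬ SatClause S₀ x) : ℝ) ≤ ε * #P := by
  refine le_trans ?_ hP
  exact_mod_cast card_le_card fun x hx => by
    rw [mem_filter] at hx ⊢
    exact ⟨hx.1, hx.2.1, fun hd => hx.2.2 (satClause_of_le hle hS₀ hd)⟩

open Classical in
/-- **Negative horn.** If the CNF of a pair is empty (the constant `1`), its negative error is the
whole set of rejected negatives: the gate must be blind on the negatives. [folklore] -/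
theorem card_filter_rej_le_of_cnf_empty (φ : GateFn) (N : Finset (ι → Bool)) (ε : ℝ)
    (C : Fin φ.1 → Finset (Finset ι))
    (hN : (#(N.filter fun x => EvalCNF (∅ : Finset (Finset ι)) x ∧ φ.2 (cval C x) = false) : ℝ)
      ≤ ε * #N) :
    (#(N.filter fun x => φ.2 (cval C x) = false) : ℝ) ≤ ε * #N := by
  have : N.filter (fun x => EvalCNF (∅ : Finset (Finset ι)) x ∧ φ.2 (cval C x) = false) =
      N.filter fun x => φ.2 (cval C x) = false :=
    filter_congr fun x _ => by simp
  rwa [this] at hN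

open Classical in
/-- **Dichotomy (sandwichable ⇒ one horn).** A gate sandwichable at localities `(r, s)` with error
`ε` is either BLIND ON THE NEGATIVES (rejects, through the CNF children, at most `ε · #N` of them) or
PIERCED ON THE POSITIVES: some set `S₀` of fewer than `s` slots is such that at most `ε · #P`
positives are accepted, through the DNF children, with `S₀` entirely off. On the referee pair a
fixed `S₀` meets the edge set of at most `#S₀ · C(m-2, k-2)` of the `C(m, k)` bare `k`-cliques, so a
sandwichable gate accepting more than `(ε + (s-1) k(k-1)/(m(m-1))) · #P` bare cliques rejects at
most `ε · #N` negatives; a counterexample to the stubs must reject `> ε · #N` negatives while its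
acceptance is spread over unboundedly many anchors. [folklore] -/
theorem sandwich_dichotomy (φ : GateFn) (P N : Finset (ι → Bool)) (ε : ℝ) {r s : ℕ}
    (D C : Fin φ.1 → Finset (Finset ι))
    (h : ∃ dnf cnf : Finset (Finset ι), IsLocal r dnf ∧ IsLocal s cnf ∧
      (∀ x, EvalDNF dnf x → EvalCNF cnf x) ∧
      (#(P.filter fun x => φ.2 (dval D x) = true ∧ ¬ EvalDNF dnf x) : ℝ) ≤ ε * #P ∧
      (#(N.filter fun x => EvalCNF cnf x ∧ φ.2 (cval C x) = false) : ℝ) ≤ ε * #N) :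
    (#(N.filter fun x => φ.2 (cval C x) = false) : ℝ) ≤ ε * #N ∨
      ∃ S₀ : Finset ι, #S₀ ≤ s - 1 ∧
        (#(P.filter fun x => φ.2 (dval D x) = true ∧ ¬ SatClause S₀ x) : ℝ) ≤ ε * #P := by
  obtain ⟨dnf, cnf, -, hs, hle, hP, hN⟩ := h
  rcases cnf.eq_empty_or_nonempty with rfl | ⟨S₀, hS₀⟩
  · exact Or.inl (card_filter_rej_le_of_cnf_empty φ N ε C hN)
  · exact Or.inr ⟨S₀, hs S₀ hS₀, card_filter_off_le_of_sandwich φ P ε D hle hS₀ hP⟩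

/-! ## §4 Characterisation: only the clause family matters -/

/-- Shrinking a transversal to the ground set of the family: if `R` meets every member of `𝓢`,
so does `R ∩ ⋃ 𝓢`, which is no larger and still inside the on-set. [folklore] -/
theorem exists_transversal_subset [DecidableEq ι] (𝓢 : Finset (Finset ι)) {R : Finset ι} {w : ℕ}
    (hR : #R ≤ w) (hRS : ∀ S ∈ 𝓢, ∃ i ∈ R, i ∈ S) {x : ι → Bool} (hx : SatTerm R x) :
    ∃ R' ∈ (𝓢.biUnion id).powerset, #R' ≤ w ∧ (∀ S ∈ 𝓢, ∃ i ∈ R', i ∈ S) ∧ SatTerm R' x := by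
  refine ⟨R.filter fun i => i ∈ 𝓢.biUnion id, mem_powerset.2 fun i hi => (mem_filter.1 hi).2,
    (card_filter_le _ _).trans hR, fun S hS => ?_, fun i hi => hx i (mem_filter.1 hi).1⟩
  obtain ⟨i, hiR, hiS⟩ := hRS S hS
  exact ⟨i, mem_filter.2 ⟨hiR, mem_biUnion.2 ⟨S, hS, hiS⟩⟩, hiS⟩

open Classical in
/-- **Characterisation of sandwichability** (`ε ≥ 0`). `φ` with children `(D, C)` is sandwichable
at localities `(r, s)` with error `ε` on `(P, N)` IFF either it rejects at most `ε · #N` negatives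
(pair `({∅}, ∅)`), or there is a NONEMPTY family `𝓢` of clauses of fewer than `s` slots such that
(a) all but `ε · #N` rejected negatives switch some `S ∈ 𝓢` entirely off (`¬ EvalCNF 𝓢`), and
(b) every subfamily of accepted positives none of which switches on a set of fewer than `r` slots
meeting every `S ∈ 𝓢` has size `≤ ε · #P` (pair (all small transversals of `𝓢` inside `⋃ 𝓢`, `𝓢`)).
Only the clause family has to be guessed; (b) is stated on subfamilies so that no decidability
instance is fixed. [folklore] -/
theorem sandwich_iff [DecidableEq ι] (φ : GateFn) (P N : Finset (ι → Bool)) {ε : ℝ} (hε : 0 ≤ ε)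
    (r s : ℕ) (D C : Fin φ.1 → Finset (Finset ι)) :
    (∃ dnf cnf : Finset (Finset ι), IsLocal r dnf ∧ IsLocal s cnf ∧
      (∀ x, EvalDNF dnf x → EvalCNF cnf x) ∧
      (#(P.filter fun x => φ.2 (dval D x) = true ∧ ¬ EvalDNF dnf x) : ℝ) ≤ ε * #P ∧
      (#(N.filter fun x => EvalCNF cnf x ∧ φ.2 (cval C x) = false) : ℝ) ≤ ε * #N) ↔
    ((#(N.filter fun x => φ.2 (cval C x) = false) : ℝ) ≤ ε * #N ∨
      ∃ 𝓢 : Finset (Finset ι), 𝓢.Nonempty ∧ IsLocal s 𝓢 ∧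
        (#(N.filter fun x => EvalCNF 𝓢 x ∧ φ.2 (cval C x) = false) : ℝ) ≤ ε * #N ∧
        ∀ E ⊆ P, (∀ x ∈ E, φ.2 (dval D x) = true ∧
          ∀ R : Finset ι, #R ≤ r - 1 → (∀ S ∈ 𝓢, ∃ i ∈ R, i ∈ S) → ¬ SatTerm R x) →
          (#E : ℝ) ≤ ε * #P) := by
  constructor
  · rintro ⟨dnf, cnf, hr, hs, hle, hP, hN⟩
    rcases cnf.eq_empty_or_nonempty with rfl | hne
    · exact Or.inl (card_filter_rej_le_of_cnf_empty φ N ε C hN)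
    · refine Or.inr ⟨cnf, hne, hs, hN, fun E hE hbad => le_trans ?_ hP⟩
      have hsub : E ⊆ P.filter fun x => φ.2 (dval D x) = true ∧ ¬ EvalDNF dnf x := by
        intro x hx
        refine mem_filter.2 ⟨hE hx, (hbad x hx).1, fun hd => ?_⟩
        obtain ⟨R, hR, hRx⟩ := hd
        exact (hbad x hx).2 R (hr R hR) (cross_of_le hle R hR) hRx
      exact_mod_cast card_le_card hsub
  · rintro (hN | ⟨𝓢, -, hs, hN, hP⟩)
    · exact exists_sandwich_of_neg_blind φ P N hε r s D C hN
    · set 𝓣 : Finset (Finset ι) :=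
        (𝓢.biUnion id).powerset.filter fun R => #R ≤ r - 1 ∧ ∀ S ∈ 𝓢, ∃ i ∈ R, i ∈ S with h𝓣
      refine exists_sandwich_of_hub φ P N ε D C 𝓣 𝓢 (fun R hR => (mem_filter.1 hR).2.1) hs
        (fun R hR => (mem_filter.1 hR).2.2) (hP _ (filter_subset _ _) fun x hx => ?_) hN
      rw [mem_filter] at hx
      refine ⟨hx.2.1, fun R hR hRS hRx => hx.2.2 ?_⟩
      obtain ⟨R', hR', h1, h2, h3⟩ := exists_transversal_subset 𝓢 hR hRS hRx
      exact ⟨R', mem_filter.2 ⟨hR', h1, h2⟩, h3⟩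

end General

/-! ## §5 Registered corollary -/

open Classical in
/-- REGISTERED SUB-GOAL of the line (binder-free): **a gate blind on one side of the pair is
sandwichable** — for any gate `φ`, index type `ι`, families `P N`, `ε ≥ 0`,
localities `r s` and children `D C`, if `φ` accepts through the DNF children at most `ε · #P`
positives or rejects through the CNF children at most `ε · #N` negatives, then a local pair
`dnf ≤ cnf` with both errors `≤ ε` exists (the conclusion of `stub_algebraicSandwichable` /
`stub_convSandwichable` for these data, unfolded as in the stubs). [folklore] -/
theorem sandwich_cheap_exit : ∀ (ι : Type) (φ : GateFn) (P N : Finset (ι → Bool))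
    (ε : ℝ), 0 ≤ ε → ∀ (r s : ℕ) (D C : Fin φ.1 → Finset (Finset ι)),
    ((#(P.filter fun x => φ.2 (fun j => decide (EvalDNF (D j) x)) = true) : ℝ) ≤ ε * #P ∨
      (#(N.filter fun x => φ.2 (fun j => decide (EvalCNF (C j) x)) = false) : ℝ) ≤ ε * #N) →
    ∃ dnf cnf : Finset (Finset ι), (∀ R ∈ dnf, #R ≤ r - 1) ∧ (∀ S ∈ cnf, #S ≤ s - 1) ∧
      (∀ x, EvalDNF dnf x → EvalCNF cnf x) ∧
      (#(P.filter fun x => φ.2 (fun j => decide (EvalDNF (D j) x)) = true ∧ ¬ EvalDNF dnf x) : ℝ)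
        ≤ ε * #P ∧
      (#(N.filter fun x => EvalCNF cnf x ∧ φ.2 (fun j => decide (EvalCNF (C j) x)) = false) : ℝ)
        ≤ ε * #N := by
  intro ι φ P N ε hε r s D C h
  rcases h with h | h
  · exact exists_sandwich_of_pos_blind φ P N hε r s D C h
  · exact exists_sandwich_of_neg_blind φ P N hε r s D C h

end Summit.PneNP.PneNP.Theorems.CliqueExtLowerBound.WidthThreshold.SandwichHelpers
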